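import Literature.NumberTheory.Weil1964.ArchMetaplecticUnitarySplittingContinuity
import Literature.NumberTheory.Weil1964.ArchMetaplecticSchurContinuity
import Literature.RepresentationTheory.KonnoKonno2007.JunctionHyperbolicVacuumPin
import Literature.RepresentationTheory.KonnoKonno2007.JunctionDetCharacters
import HarnessLib

/-!
# The archimedean Weil datum of the real unitary dual pair `U(P,Q) × U(R,S)` and Konno–Konno's Lemma 5.2 (vacuum
# eigencharacter) at EVERY signature, hypothesis-free

Topic `RepresentationTheory/KonnoKonno2007`; namespace `Literature.RepresentationTheory.KonnoKonno2007.RealDualPair`.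
KERNEL ONLY: theorems; no definition, no record, no hypothesis, no `sorry`.  Junction of

* `Weil1964.ArchMetaplecticUnitarySplitting` — the `det^{1/2}`-normalised splitting `UnitaryWeil.weilHom : U(α,β) →*
  Mp^𝓢(W)` over `toSp` (HOMOMORPHISM at every signature; `C(weilElt G) = (det d(G))⁻¹`; `weilRep` its operator form);
* `Weil1964.ArchMetaplecticUnitarySplittingContinuity` — (w1) for the first factor: `(g, f) ↦ weilRepV g f` is
  jointly continuous on `U(P,Q) × 𝓢` (`continuous_uncurry_weilRepV`, `KAK` at arbitrary rank), and the Schur transfer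
  of joint continuity along the vacuum coefficient (`continuous_uncurry_of_vacCoeffS`);
* `Weil1964.ArchMetaplecticSchurContinuity` — Schur's scalar read at the vacuum (`MpS.apply_eq_vac_div_vac_smul`);
* `KonnoKonno2007.JunctionHyperbolicVacuumPin` §4 — transport of implementers along the `V ↔ W` swap
  (`isImplementerS_swap_conj`, `vacCoeffS_swap_conj`), and `KonnoKonno2007.JunctionDetCharacters` — the exponent family
  of the record `FockVacuumCharacter` is an affine plane through any ONE realised tuple (`fockVacuumCharacter_junction_iff`).

THE RESULTS, for ALL finite `P, Q, R, S` (every signature `(|P|,|Q|;|R|,|S|)`, every real rank):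

* §1 **the pair's Weil representation** is `ω := weilRep ∘ toBig : U(P,Q) × U(R,S) →* End 𝓢(ℝ^{DPIdx})`, `g ↦ (the
  operator of) weilElt (g_V ⊗ g_W)`; its `W`-slice `h ↦ ω(1,h)` is jointly continuous — by Schur transfer from the
  `V`-slice of the SWAPPED pair `(U(R,S), U(P,Q))` conjugated by the swap (`continuous_uncurry_weilRepPair_inr`); with
  the `V`-slice (`continuous_uncurry_weilRepV`) and `ω(g,h) = ω(g,1) ∘ ω(1,h)`: **`continuous_uncurry_weilRepPair`**;
* §2 **`isArchWeilDatum_weilRepPair`**: `ω` is an archimedean Weil datum over `ι𝕎 = ι_{V,W}` — (w1) strong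
  continuity, (w2) Heisenberg covariance, (w2′) unitary lifts — WITH NO HYPOTHESIS;
* §3 **the vacuum eigencharacter** [KonnoKonno2007, Lemma 5.2]: on the maximal compact
  `K_V × K_W = (U(P) × U(Q)) × (U(R) × U(S))`, `ω(κ((a,b),(c,d))) h₀ = det(a)^{−|S|} det(b)^{−|R|} det(c)^{−|Q|} det(d)^{−|P|} · h₀`
  (`weilRepPair_κ_hermitePi_zero`: Schur against Folland's `μ₀ = unitaryOpPi`, which FIXES the Gaussian, and
  `C(weilElt(diag(a,b) ⊗ diag(c,d))) = det(a ⊗ d)⁻¹ det(b ⊗ c)⁻¹` from the block form `diag(a⊗c, b⊗d | a⊗d, b⊗c)`);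
* §4 **`fockVacuumCharacter_junction_general`**: the record `(junction P Q R S).FockVacuumCharacter ⟨−|S|, −|R|, −|Q|, −|P|⟩`
  HOLDS; hence the COMPLETE exponent family at every signature with all four blocks non-empty
  (`fockVacuumCharacter_junction_iff_general`: `f` realised iff `f_P − f_Q = |R| − |S|` and `f_R − f_S = |P| − |Q|`),
  the whole affine plane through the base tuple unconditionally (`fockVacuumCharacter_junction_of_sub_eq_sub`), and
  the definite-`W` families (`…_iff_general_of_isEmpty_right/left`).  The tree's instance `fockVacuumCharacter_ι₁`
  (`U(2,1) × U(1)`, tuple `(0,−1,0,0)`) is the case `(P,Q,R,S) = (Fin 2, Unit, Unit, ∅)` of the base tuple.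

Consistency with the tree's necessary conditions: `e_P − e_Q = −|S| + |R|` (`eP_sub_eQ`) and `e_R − e_S = −|Q| + |P|`
(`eR_sub_eS`) — the base tuple sits on both pins.

## References

* [KonnoKonno2007] K. Konno, T. Konno, *On doubling construction for real unitary dual pairs*, Kyushu J. Math. 61
  (2007) 35–82: §3.1 (3.1), §3.3 p. 47, Lemma 5.2 (i)/(ii) p. 73, Thm 5.4 (i) (5.6)–(5.7) p. 75
  (doi:10.2206/kyushujm.61.35).
* [Folland1989] G. B. Folland, *Harmonic Analysis in Phase Space*, Princeton UP 1989, §4.2 (4.23), the Schur remark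
  p. 156, (4.36), Prop. (4.39).
* [Kudla1994] S. S. Kudla, *Splitting metaplectic covers of dual reductive pairs*, Israel J. Math. 87 (1994), §5.
* [Paul1998] A. Paul, *Howe correspondence for real unitary groups*, J. Funct. Anal. 159 (1998), §1.2 (1.2.1)–(1.2.2).
-/

set_option autoImplicit false

noncomputable section

open Matrix Complex MeasureTheory SchwartzMap
open scoped Kronecker ComplexConjugate

namespace Literature.RepresentationTheory.KonnoKonno2007

namespace RealDualPair

open Literature.Analysis.SegalBargmann Literature.RepresentationTheory.HeisenbergGroup
open Literature.NumberTheory.Weil1964 Literature.NumberTheory.Weil1964.MpS Literature.NumberTheory.Weil1964.UnitaryBall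
open Literature.NumberTheory.Weil1964.UnitaryWeil
open Literature.NumberTheory.Automorphic Literature.NumberTheory.Automorphic.UnitaryGroup

variable {P Q R S : Type*} [Fintype P] [DecidableEq P] [Fintype Q] [DecidableEq Q] [Fintype R] [DecidableEq R]
  [Fintype S] [DecidableEq S]

/-! ## 1. The pair's Weil representation `weilRep ∘ toBig` and its joint continuity -/

/-- Unfolding: the pair's Weil representation acts by the operator of `weilElt (g_V ⊗ g_W)`.
[cite: Kudla1994, §5; KonnoKonno2007, §3.3 p. 47] -/
theorem weilRepPair_apply (g : Ginf P Q R S) (f : SchwartzMap (DPIdx P Q R S → ℝ) ℂ) :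
    (weilRep (α := (P × R) ⊕ (Q × S)) (β := (P × S) ⊕ (Q × R))).comp (toBig P Q R S) g f =
      (weilElt (toBig P Q R S g)).1.2 f := rfl

/-- On the first factor the pair's representation is `weilRepV`. [cite: KonnoKonno2007, §3.3 p. 47] -/
theorem weilRepPair_inl (g : UForm P Q) (f : SchwartzMap (DPIdx P Q R S → ℝ) ℂ) :
    (weilRep (α := (P × R) ⊕ (Q × S)) (β := (P × S) ⊕ (Q × R))).comp (toBig P Q R S) (g, 1) f =
      weilRepV P Q R S g f := rfl

/-- `weilElt (g_V ⊗ g_W)` (as an operator) implements the phase map of `ι𝕎 (g_V, g_W)`. [cite: Folland1989, §4.2 (4.23)] -/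
theorem isImplementerS_weilElt_toBig (g : Ginf P Q R S) :
    IsImplementerS (⇑((ι𝕎 P Q R S g).1 : ((DPIdx P Q R S → ℝ) × (DPIdx P Q R S → ℝ)) ≃ₗ[ℝ]
        ((DPIdx P Q R S → ℝ) × (DPIdx P Q R S → ℝ))))
      (((weilElt (toBig P Q R S g)).1.2 : SchwartzMap (DPIdx P Q R S → ℝ) ℂ ≃L[ℂ] SchwartzMap (DPIdx P Q R S → ℝ) ℂ) :
        SchwartzMap (DPIdx P Q R S → ℝ) ℂ →L[ℂ] SchwartzMap (DPIdx P Q R S → ℝ) ℂ) := by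
  have h := MpS.isImplementerS_self (weilElt (toBig P Q R S g))
  rw [proj_weilElt] at h
  exact h

/-- `h ↦ 1_V ⊗ h` is continuous. [cite: KonnoKonno2007, §3.1 (3.1)] -/
private theorem continuous_toBig_inr' : Continuous fun h : UForm R S => toBig P Q R S (1, h) :=
  continuous_toBig.comp (continuous_const.prodMk continuous_id)

/-- the comparison family on the second factor: `swapS ∘ weilHomV_{RSPQ} h ∘ swapS⁻¹` implements `ι𝕎 (1, h)`.
[cite: KonnoKonno2007, §3.1 (3.1); Folland1989, §4.2 (4.23)] -/
theorem isImplementerS_swap_weilHomV (h : UForm R S) :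
    IsImplementerS (⇑((ι𝕎 P Q R S ((1 : UForm P Q), h)).1 : ((DPIdx P Q R S → ℝ) × (DPIdx P Q R S → ℝ)) ≃ₗ[ℝ]
        ((DPIdx P Q R S → ℝ) × (DPIdx P Q R S → ℝ))))
      ((((swapS R S P Q : SchwartzMap (DPIdx R S P Q → ℝ) ℂ ≃L[ℂ] SchwartzMap (DPIdx P Q R S → ℝ) ℂ) :
          SchwartzMap (DPIdx R S P Q → ℝ) ℂ →L[ℂ] SchwartzMap (DPIdx P Q R S → ℝ) ℂ).comp
        ((((weilHomV R S P Q h).1.2 : SchwartzMap (DPIdx R S P Q → ℝ) ℂ ≃L[ℂ] SchwartzMap (DPIdx R S P Q → ℝ) ℂ) :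
            SchwartzMap (DPIdx R S P Q → ℝ) ℂ →L[ℂ] SchwartzMap (DPIdx R S P Q → ℝ) ℂ).comp
          (((swapS R S P Q).symm : SchwartzMap (DPIdx P Q R S → ℝ) ℂ ≃L[ℂ] SchwartzMap (DPIdx R S P Q → ℝ) ℂ) :
            SchwartzMap (DPIdx P Q R S → ℝ) ℂ →L[ℂ] SchwartzMap (DPIdx R S P Q → ℝ) ℂ)))) :=
  isImplementerS_swap_conj P Q (g := (((1 : UForm P Q), h) : Ginf P Q R S)) (isImplementerS_weilHomV h)

/-- … with non-zero vacuum coefficient `C(weilHomV_{RSPQ} h)`. [cite: Folland1989, §4.2 (4.36), Prop. (4.39)] -/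
theorem vacCoeffS_swap_weilHomV_ne_zero (h : UForm R S) :
    vacCoeffS ((((swapS R S P Q : SchwartzMap (DPIdx R S P Q → ℝ) ℂ ≃L[ℂ] SchwartzMap (DPIdx P Q R S → ℝ) ℂ) :
          SchwartzMap (DPIdx R S P Q → ℝ) ℂ →L[ℂ] SchwartzMap (DPIdx P Q R S → ℝ) ℂ).comp
        ((((weilHomV R S P Q h).1.2 : SchwartzMap (DPIdx R S P Q → ℝ) ℂ ≃L[ℂ] SchwartzMap (DPIdx R S P Q → ℝ) ℂ) :
            SchwartzMap (DPIdx R S P Q → ℝ) ℂ →L[ℂ] SchwartzMap (DPIdx R S P Q → ℝ) ℂ).comp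
          (((swapS R S P Q).symm : SchwartzMap (DPIdx P Q R S → ℝ) ℂ ≃L[ℂ] SchwartzMap (DPIdx R S P Q → ℝ) ℂ) :
            SchwartzMap (DPIdx P Q R S → ℝ) ℂ →L[ℂ] SchwartzMap (DPIdx R S P Q → ℝ) ℂ)))) ≠ 0 := by
  rw [vacCoeffS_swap_conj]
  exact vac_weilHomV_ne_zero h

/-- … and jointly continuous in `(h, f)` (the swapped pair's (w1) read back through the swap).
[cite: Folland1989, §4.2 p. 156; Knapp2002, Thm 7.39] -/
theorem continuous_uncurry_swap_weilHomV :
    Continuous fun x : UForm R S × SchwartzMap (DPIdx P Q R S → ℝ) ℂ =>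
      swapS R S P Q ((weilHomV R S P Q x.1).1.2 ((swapS R S P Q).symm x.2)) := by
  have h0 : Continuous fun p : UForm R S × SchwartzMap (DPIdx R S P Q → ℝ) ℂ => (weilHomV R S P Q p.1).1.2 p.2 :=
    continuous_uncurry_weilRepV
  have h2 : Continuous fun x : UForm R S × SchwartzMap (DPIdx P Q R S → ℝ) ℂ =>
      ((x.1, (swapS R S P Q).symm x.2) : UForm R S × SchwartzMap (DPIdx R S P Q → ℝ) ℂ) :=
    continuous_fst.prodMk ((swapS R S P Q).symm.continuous.comp continuous_snd)
  have h3 := (swapS R S P Q).continuous.comp (h0.comp h2)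
  simp only [Function.comp_def] at h3
  exact h3

/-- **The `W`-slice is jointly continuous** (operator form): `(h, f) ↦ weilElt(1 ⊗ h) f` is continuous
`U(R,S) × 𝓢 → 𝓢` — Schur transfer (continuous vacuum coefficient `(det d(1 ⊗ h))⁻¹`) from the swap-conjugate of the
`V`-slice of the swapped pair. [cite: Folland1989, §4.2, the Schur remark p. 156; KonnoKonno2007, §3.1 (3.1)] -/
theorem continuous_uncurry_weilElt_toBig_inr :
    Continuous fun x : UForm R S × SchwartzMap (DPIdx P Q R S → ℝ) ℂ => (weilElt (toBig P Q R S (1, x.1))).1.2 x.2 :=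
  continuous_uncurry_of_vacCoeffS (X := UForm R S)
    (γ := fun h : UForm R S => ⇑((ι𝕎 P Q R S ((1 : UForm P Q), h)).1 :
      ((DPIdx P Q R S → ℝ) × (DPIdx P Q R S → ℝ)) ≃ₗ[ℝ] ((DPIdx P Q R S → ℝ) × (DPIdx P Q R S → ℝ))))
    (A := fun h : UForm R S => (((weilElt (toBig P Q R S (1, h))).1.2 :
      SchwartzMap (DPIdx P Q R S → ℝ) ℂ ≃L[ℂ] SchwartzMap (DPIdx P Q R S → ℝ) ℂ) :
        SchwartzMap (DPIdx P Q R S → ℝ) ℂ →L[ℂ] SchwartzMap (DPIdx P Q R S → ℝ) ℂ))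
    (W := fun h : UForm R S =>
      (((swapS R S P Q : SchwartzMap (DPIdx R S P Q → ℝ) ℂ ≃L[ℂ] SchwartzMap (DPIdx P Q R S → ℝ) ℂ) :
          SchwartzMap (DPIdx R S P Q → ℝ) ℂ →L[ℂ] SchwartzMap (DPIdx P Q R S → ℝ) ℂ).comp
        ((((weilHomV R S P Q h).1.2 : SchwartzMap (DPIdx R S P Q → ℝ) ℂ ≃L[ℂ] SchwartzMap (DPIdx R S P Q → ℝ) ℂ) :
            SchwartzMap (DPIdx R S P Q → ℝ) ℂ →L[ℂ] SchwartzMap (DPIdx R S P Q → ℝ) ℂ).comp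
          (((swapS R S P Q).symm : SchwartzMap (DPIdx P Q R S → ℝ) ℂ ≃L[ℂ] SchwartzMap (DPIdx R S P Q → ℝ) ℂ) :
            SchwartzMap (DPIdx P Q R S → ℝ) ℂ →L[ℂ] SchwartzMap (DPIdx R S P Q → ℝ) ℂ))))
    (fun h => isImplementerS_weilElt_toBig ((1 : UForm P Q), h)) isImplementerS_swap_weilHomV
    vacCoeffS_swap_weilHomV_ne_zero (continuous_vac_weilElt.comp continuous_toBig_inr') continuous_uncurry_swap_weilHomV

/-- **The `W`-slice is jointly continuous**: `(h, f) ↦ ω(1, h) f` is continuous `U(R,S) × 𝓢 → 𝓢`.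
[cite: Folland1989, §4.2, the Schur remark p. 156; KonnoKonno2007, §3.1 (3.1)] -/
theorem continuous_uncurry_weilRepPair_inr :
    Continuous fun x : UForm R S × SchwartzMap (DPIdx P Q R S → ℝ) ℂ =>
      (weilRep (α := (P × R) ⊕ (Q × S)) (β := (P × S) ⊕ (Q × R))).comp (toBig P Q R S) (1, x.1) x.2 := by
  simp only [weilRepPair_apply]
  exact continuous_uncurry_weilElt_toBig_inr

/-- **(w1), joint form, for the PAIR**: `((g_V, g_W), f) ↦ ω(g_V, g_W) f` is continuous
`(U(P,Q) × U(R,S)) × 𝓢 → 𝓢`, at every signature and real rank. [cite: Folland1989, §4.2 p. 156; KonnoKonno2007, §3.3 p. 47] -/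
theorem continuous_uncurry_weilRepPair :
    Continuous fun x : Ginf P Q R S × SchwartzMap (DPIdx P Q R S → ℝ) ℂ =>
      (weilRep (α := (P × R) ⊕ (Q × S)) (β := (P × S) ⊕ (Q × R))).comp (toBig P Q R S) x.1 x.2 := by
  refine continuous_uncurry_prod _ ?_ continuous_uncurry_weilRepPair_inr
  simp only [weilRepPair_inl]
  exact continuous_uncurry_weilRepV

/-- (w1): every orbit map `g ↦ ω g f` of the pair is continuous into `𝓢`. [cite: Folland1989, §4.2 p. 156] -/
theorem continuous_weilRepPair_apply (f : SchwartzMap (DPIdx P Q R S → ℝ) ℂ) :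
    Continuous fun g : Ginf P Q R S =>
      (weilRep (α := (P × R) ⊕ (Q × S)) (β := (P × S) ⊕ (Q × R))).comp (toBig P Q R S) g f :=
  continuous_uncurry_weilRepPair.comp (f := fun g : Ginf P Q R S => (g, f)) (continuous_id.prodMk continuous_const)

/-- **`weilHom ∘ toBig : U(P,Q) × U(R,S) → Mp^𝓢(𝕎)` is continuous** (strong operator topology).
[cite: Folland1989, §4.2 p. 156 L24; Kudla1994, §5] -/
theorem continuous_weilHom_toBig : Continuous fun g : Ginf P Q R S =>
    weilHom (α := (P × R) ⊕ (Q × S)) (β := (P × S) ⊕ (Q × R)) (toBig P Q R S g) :=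
  MpS.continuous_iff.2 fun f => toL2.continuous.comp (continuous_weilRepPair_apply f)

/-! ## 2. The archimedean Weil datum of the pair, hypothesis-free -/

variable (P Q R S) in
/-- **THE ARCHIMEDEAN WEIL DATUM OF THE REAL UNITARY DUAL PAIR `U(P,Q) × U(R,S)`** over `ι𝕎 = ι_{V,W}`:
`weilRep ∘ toBig` satisfies (w1) strong continuity, (w2) Heisenberg covariance, (w2′) unitary lifts — WITH NO
HYPOTHESIS, at every signature and real rank (character class fixed by the `det^{1/2}` normalisation).
[cite: KonnoKonno2007, §3.3 p. 47 L51–85; Kudla1994, §5; Folland1989, §4.2 (4.23), Prop. (4.27)] -/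
theorem isArchWeilDatum_weilRepPair :
    IsArchWeilDatum (ι𝕎 P Q R S)
      ((weilRep (α := (P × R) ⊕ (Q × S)) (β := (P × S) ⊕ (Q × R))).comp (toBig P Q R S)) where
  continuous_apply := continuous_weilRepPair_apply
  covariant := fun g p q f => by
    have h := ((MpS.mem_iff_covariant _).1 (weilElt (toBig P Q R S g)).2).1 p q f
    have hp : (weilElt (toBig P Q R S g)).1.1 = ι𝕎 P Q R S g := proj_weilElt _
    rw [hp] at h
    exact h
  exists_lift := fun g => ((MpS.mem_iff_covariant _).1 (weilElt (toBig P Q R S g)).2).2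

/-- the junction record's datum clause, discharged: SOME archimedean Weil datum over `ι_{V,W}` exists, at every
signature. [cite: KonnoKonno2007, §3.3 p. 47 L51–85] -/
theorem exists_isArchWeilDatum_junction :
    ∃ ω : Representation ℂ (Ginf P Q R S) (SchwartzMap (DPIdx P Q R S → ℝ) ℂ), IsArchWeilDatum (ι𝕎 P Q R S) ω :=
  ⟨_, isArchWeilDatum_weilRepPair P Q R S⟩

/-! ## 3. The vacuum eigencharacter on `K_V × K_W` (Konno–Konno Lemma 5.2, vacuum part) -/

/-- **`det d(diag(a,b) ⊗ diag(c,d))`**: the mixed-sign block of `κ((a,b),(c,d))` in the big group is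
`diag(a ⊗ d, b ⊗ c)`, of determinant `det(a)^{|S|} det(d)^{|P|} · det(b)^{|R|} det(c)^{|Q|}`. [cite: KonnoKonno2007, §3.1 (3.1), Lemma 5.2 p. 73] -/
theorem det_d_toBig_κ (k : DPK P Q R S) :
    (d (toBig P Q R S (κ P Q R S k))).det =
      (k.1.1 : Matrix P P ℂ).det ^ Fintype.card S * (k.2.2 : Matrix S S ℂ).det ^ Fintype.card P *
        ((k.1.2 : Matrix Q Q ℂ).det ^ Fintype.card R * (k.2.1 : Matrix R R ℂ).det ^ Fintype.card Q) := by
  have hmat : mat (toBig P Q R S (κ P Q R S k)) =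
      Matrix.fromBlocks (Matrix.fromBlocks ((k.1.1 : Matrix P P ℂ) ⊗ₖ (k.2.1 : Matrix R R ℂ)) 0 0
          ((k.1.2 : Matrix Q Q ℂ) ⊗ₖ (k.2.2 : Matrix S S ℂ))) 0 0
        (Matrix.fromBlocks ((k.1.1 : Matrix P P ℂ) ⊗ₖ (k.2.2 : Matrix S S ℂ)) 0 0
          ((k.1.2 : Matrix Q Q ℂ) ⊗ₖ (k.2.1 : Matrix R R ℂ))) := by
    rw [mat, coe_toBig]
    show Matrix.reindex (dpEquiv P Q R S) (dpEquiv P Q R S)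
      ((((UForm.kV P Q k.1 : UForm P Q) : GL (P ⊕ Q) ℂ) : Matrix (P ⊕ Q) (P ⊕ Q) ℂ) ⊗ₖ
        (((UForm.kV R S k.2 : UForm R S) : GL (R ⊕ S) ℂ) : Matrix (R ⊕ S) (R ⊕ S) ℂ)) = _
    rw [UForm.coe_kV, UForm.coe_kV, reindex_kronecker_fromBlocks]
  rw [d, hmat, Matrix.toBlocks_fromBlocks₂₂, Matrix.det_fromBlocks_zero₂₁, Matrix.det_kronecker,
    Matrix.det_kronecker]

/-- **On the maximal compact, `weilElt` is `C · μ₀`**: `weilElt(κ k) f = (det d(κ k))⁻¹ · unitaryOpPi (dualPairι k) f`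
(Schur against Folland's `μ₀`, whose vacuum coefficient is `1`). [cite: Folland1989, Prop. (4.39), §4.2 p. 156; KonnoKonno2007, §3.1] -/
theorem weilElt_toBig_κ_apply (k : DPK P Q R S) (f : SchwartzMap (DPIdx P Q R S → ℝ) ℂ) :
    (weilElt (toBig P Q R S (κ P Q R S k))).1.2 f =
      ((d (toBig P Q R S (κ P Q R S k))).det)⁻¹ • unitaryOpPi (dualPairι k) f := by
  have hp : proj (MpS.unitary (dualPairι k)) = proj (weilElt (toBig P Q R S (κ P Q R S k))) := by
    rw [proj_unitary, proj_weilElt, ← ι𝕎_κ]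
    rfl
  rw [MpS.apply_eq_vac_div_vac_smul hp f, vac_weilElt, vac_unitary, div_one]
  rfl

/-- **[KonnoKonno2007, Lemma 5.2] — THE VACUUM IS A `K_V × K_W`-EIGENVECTOR, AT EVERY SIGNATURE**:
`ω(κ((a,b),(c,d))) h₀ = det(a)^{−|S|} det(b)^{−|R|} det(c)^{−|Q|} det(d)^{−|P|} · h₀`, i.e. the eigencharacter is
`vacScalar ⟨−|S|, −|R|, −|Q|, −|P|⟩`. [cite: KonnoKonno2007, Lemma 5.2 (i)/(ii) p. 73 L44–102; Folland1989, Prop. (4.39)] -/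
theorem weilRepPair_κ_hermitePi_zero (k : DPK P Q R S) :
    (weilRep (α := (P × R) ⊕ (Q × S)) (β := (P × S) ⊕ (Q × R))).comp (toBig P Q R S) (κ P Q R S k) (hermitePi 0) =
      vacScalar (⟨-(Fintype.card S : ℤ), -(Fintype.card R : ℤ), -(Fintype.card Q : ℤ), -(Fintype.card P : ℤ)⟩ :
        VacExponents) k • hermitePi 0 := by
  rw [weilRepPair_apply, weilElt_toBig_κ_apply, unitaryOpPi_hermitePi_zero, det_d_toBig_κ]
  congr 1
  simp only [vacScalar, _root_.zpow_neg, zpow_natCast, mul_inv]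
  ring

/-! ## 4. The record `FockVacuumCharacter` at every signature, and the complete exponent family -/

variable (P Q R S) in
/-- **THE RECORD `FockVacuumCharacter` OF THE JUNCTION HOLDS AT EVERY SIGNATURE** with the base tuple
`(e_P, e_Q, e_R, e_S) = (−|S|, −|R|, −|Q|, −|P|)`: there is an archimedean Weil datum over `ι_{V,W}` (namely
`weilRep ∘ toBig`) on whose vacuum `K_V × K_W` acts by that determinant character — NO HYPOTHESIS.
[cite: KonnoKonno2007, Lemma 5.2 (i)/(ii) p. 73 L44–102, §3.3 p. 47 L51–85; Folland1989, Prop. (4.39)] -/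
theorem fockVacuumCharacter_junction_general :
    (junction P Q R S).FockVacuumCharacter
      ⟨-(Fintype.card S : ℤ), -(Fintype.card R : ℤ), -(Fintype.card Q : ℤ), -(Fintype.card P : ℤ)⟩ :=
  ⟨_, isArchWeilDatum_weilRepPair P Q R S, weilRepPair_κ_hermitePi_zero⟩

/-- **the whole affine plane through the base tuple is realised, unconditionally**: every `f` with
`f_P + |S| = f_Q + |R|` and `f_R + |Q| = f_S + |P|` is a vacuum exponent tuple of some archimedean Weil datum over the
junction (twist by `det(g_V)^m det(g_W)^{m′}`). [cite: KonnoKonno2007, Lemma 5.2 p. 73, Thm 5.4 (i) (5.6)–(5.7) p. 75] -/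
theorem fockVacuumCharacter_junction_of_sub_eq_sub (f : VacExponents)
    (hPQ : f.eP + Fintype.card S = f.eQ + Fintype.card R) (hRS : f.eR + Fintype.card Q = f.eS + Fintype.card P) :
    (junction P Q R S).FockVacuumCharacter f :=
  (fockVacuumCharacter_junction_general P Q R S).of_sub_eq_sub_junction f
    (by dsimp only; linarith) (by dsimp only; linarith)

/-- **THE COMPLETE EXPONENT FAMILY AT EVERY SIGNATURE (all four blocks non-empty), hypothesis-free**: `f` is a vacuum
exponent tuple of SOME archimedean Weil datum over the junction iff `f_P − f_Q = |R| − |S|` and `f_R − f_S = |P| − |Q|`.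
[cite: KonnoKonno2007, Lemma 5.2 (i)/(ii) p. 73 L44–102, Thm 5.4 (i) (5.6)–(5.7) p. 75] -/
theorem fockVacuumCharacter_junction_iff_general (p₀ : P) (q₀ : Q) (r₀ : R) (s₀ : S) (f : VacExponents) :
    (junction P Q R S).FockVacuumCharacter f ↔
      (f.eP - f.eQ = (Fintype.card R : ℤ) - Fintype.card S ∧ f.eR - f.eS = (Fintype.card P : ℤ) - Fintype.card Q) :=
  fockVacuumCharacter_junction_iff (fockVacuumCharacter_junction_general P Q R S) p₀ q₀ r₀ s₀ f

/-- **definite `W` on the right (`S = ∅`)**: `f` is realised iff `f_P − f_Q = |R|` (both `W`-exponents free).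
[cite: KonnoKonno2007, Lemma 5.2 p. 73, Thm 5.4 (i) p. 75] -/
theorem fockVacuumCharacter_junction_iff_general_of_isEmpty_right [IsEmpty S] (p₀ : P) (q₀ : Q) (f : VacExponents) :
    (junction P Q R S).FockVacuumCharacter f ↔ f.eP - f.eQ = Fintype.card R :=
  fockVacuumCharacter_junction_iff_of_isEmpty_right (fockVacuumCharacter_junction_general P Q R S) p₀ q₀ f

/-- **definite `W` on the left (`R = ∅`)**: `f` is realised iff `f_P − f_Q = −|S|`.
[cite: KonnoKonno2007, Lemma 5.2 p. 73, Thm 5.4 (i) p. 75] -/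
theorem fockVacuumCharacter_junction_iff_general_of_isEmpty_left [IsEmpty R] (p₀ : P) (q₀ : Q) (f : VacExponents) :
    (junction P Q R S).FockVacuumCharacter f ↔ f.eP - f.eQ = -(Fintype.card S : ℤ) :=
  fockVacuumCharacter_junction_iff_of_isEmpty_left (fockVacuumCharacter_junction_general P Q R S) p₀ q₀ f

end RealDualPair

end Literature.RepresentationTheory.KonnoKonno2007
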